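import Summits.FinalStateConjecture.FinalStateConjecture.Theorems.SoloBlindDispersal
import Summits.FinalStateConjecture.FinalStateConjecture.Theorems.SoloBlindInvariance
import Literature.Geometry.Lorentzian.MinkowskiStabilityCauchy
import Literature.Geometry.Lorentzian.CauchyProblemMGHDExistence

/-!
# Solo (blind) — rung r1b: small data disperse, in the typed sense of the statement

The **tied consequence form of the stability of Minkowski space**, recorded as a HYPOTHESIS
(`SoloBlindTiedMinkowskiStability`, a `Prop`, never asserted): the corrected consequence form of
Christodoulou–Klainerman 1993 / Bieri 2010 for general vacuum data on `ℝ³`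
(`christodoulou_klainerman_bieri_stability_minkowski_cauchy`, recorded in the module docstring of
`Literature.Geometry.Lorentzian.MinkowskiStabilityCauchy`: maximal development of `ε`-small
CK-decaying maximal vacuum data is causally geodesically complete, has complete `𝓘⁺`, and
converges to `η` in `Cᵏ` on all of its carrier) with its last conjunct STRENGTHENED from
`ConvergesToMinkowski univ k` to the existence of a tied late flat chart in `C²`
(`SoloBlindTiedFlatChart`, file `SoloBlindDispersal`: the same late embedding and `C²` decay, plus
(c) late region inside `J⁺(ι X)` and (d) future timelike chart time) — in two shapes, universal over
maximal developments (`SoloBlindTiedMinkowskiStability`, the shape of the recorded fact) and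
existential (`SoloBlindTiedMinkowskiStabilityExists`).

Consequences (rung r1b of the solo ladder): under the hypothesis, every datum of the Bieri–CK
smallness class on `ℝ³` SETTLES in the sense of `FinalStateConjecture` — a maximal vacuum Cauchy
development exists (from the existential shape, or from the universal shape and the
Choquet-Bruhat–Geroch fact `choquetBruhat_geroch_exists_mghd_cauchy`), and EVERY maximal vacuum
Cauchy development has complete `𝓘⁺` and an (`N = 0`) final state decomposition satisfying all
clauses of the statement (`SoloBlindSettles`, by the `N = 0` packaging theorem
`SoloBlindTiedFlatChart.settles` and the isometry invariance of the conclusion,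
`soloBlind_settles_iff_exists`).

What this does NOT give: membership of such data in `admissibleVacuumData Minkowski.slice` is not
needed for `SoloBlindSettles` and is not claimed; and the hypothesis is stronger than the recorded
consequence form exactly by (c)–(d) (gaps F1–F2 of `SoloBlindDispersal`), which the printed proofs
supply (CK 1993, Thm. 10.2.1; Bieri 2010, Thm. 3) but the tree does not record.

References: D. Christodoulou, S. Klainerman, *The global nonlinear stability of the Minkowski
space*, Princeton 1993, Thm. 1.0.3 (p. 20), Thm. 10.2.1 (p. 237); L. Bieri, J. Differential
Geom. 86 (2010) 17–70, Thm. 1, Thm. 3 (arXiv:0904.0620, pp. 3, 10); Y. Choquet-Bruhat, R. Geroch,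
Commun. Math. Phys. 14 (1969), Thm. 3 (p. 332).
-/

noncomputable section

open Literature.Geometry.Lorentzian TopologicalSpace Manifold Filter Topology Set Function
open scoped ContDiff Topology ENNReal

namespace Summit.FinalStateConjecture.FinalStateConjecture.Theorems

/-- **Hypothesis (NOT asserted): tied stability of Minkowski space, universal shape.** For every
vacuum, maximal (`tr k = 0`) datum on `ℝ³` with the Christodoulou–Klainerman fall-off, `ε`-close
to the trivial datum in the weighted Sobolev distance `dataWeightedSobolevEDist s δ`,
`δ ∈ (-3/2, -1/2)` (the data class of `christodoulou_klainerman_bieri_stability_minkowski_cauchy`),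
every maximal vacuum Cauchy development has complete future null infinity (sojourn form) and
carries a tied late flat chart in `C²` (`SoloBlindTiedFlatChart`). The recorded consequence form
asserts, in the last conjunct, only `ConvergesToMinkowski univ k`; the maximal-foliation charts of
the printed proofs are tied and future-oriented (Christodoulou–Klainerman 1993, Thm. 10.2.1;
Bieri 2010, Thm. 3). -/
def SoloBlindTiedMinkowskiStability : Prop :=
  ∃ (s : ℕ), ∃ δ ∈ Set.Ioo (-3 / 2 : ℝ) (-1 / 2), ∃ ε > (0 : ℝ),
    ∀ (D : InitialDataSet 𝓘(ℝ, E3) Minkowski.slice) [D.metric.HasLeviCivita],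
      D.IsVacuumConstraintSolution → D.IsMaximalData →
      (∃ M : ℝ, trivialAFEnd.IsStronglyAsymptoticallyFlatCK D M) →
      InitialDataSet.dataWeightedSobolevEDist s δ D trivialData < ENNReal.ofReal ε →
      ∀ 𝒟 : VacuumCauchyDevelopment D, 𝒟.IsMaximal →
        HasCompleteNullInfinity 𝒟.toCauchyDevelopment ∧
          Nonempty (SoloBlindTiedFlatChart 𝒟.toCauchyDevelopment 2)

/-- **Hypothesis (NOT asserted): tied stability of Minkowski space, existential shape** — for the
same data class, SOME maximal vacuum Cauchy development has complete `𝓘⁺` and a tied late flat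
chart in `C²` (Christodoulou–Klainerman 1993, Thm. 1.0.3, read as constructing the maximal
development). -/
def SoloBlindTiedMinkowskiStabilityExists : Prop :=
  ∃ (s : ℕ), ∃ δ ∈ Set.Ioo (-3 / 2 : ℝ) (-1 / 2), ∃ ε > (0 : ℝ),
    ∀ (D : InitialDataSet 𝓘(ℝ, E3) Minkowski.slice) [D.metric.HasLeviCivita],
      D.IsVacuumConstraintSolution → D.IsMaximalData →
      (∃ M : ℝ, trivialAFEnd.IsStronglyAsymptoticallyFlatCK D M) →
      InitialDataSet.dataWeightedSobolevEDist s δ D trivialData < ENNReal.ofReal ε →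
      ∃ 𝒟 : VacuumCauchyDevelopment D, 𝒟.IsMaximal ∧
        HasCompleteNullInfinity 𝒟.toCauchyDevelopment ∧
          Nonempty (SoloBlindTiedFlatChart 𝒟.toCauchyDevelopment 2)

/-- The universal shape and MGHD existence (Choquet-Bruhat–Geroch 1969, Thm. 3, as the fact
`choquetBruhat_geroch_exists_mghd_cauchy`) give the existential shape. -/
theorem soloBlindTiedMinkowskiStabilityExists_of (h : SoloBlindTiedMinkowskiStability)
    (hCBG : choquetBruhat_geroch_exists_mghd_cauchy) : SoloBlindTiedMinkowskiStabilityExists := by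
  obtain ⟨s, δ, hδ, ε, hε, H⟩ := h
  refine ⟨s, δ, hδ, ε, hε, fun D _ hvac hmax hCK hsmall ↦ ?_⟩
  obtain ⟨𝒟, h𝒟⟩ := hCBG Minkowski.slice D hvac
  exact ⟨𝒟, h𝒟, H D hvac hmax hCK hsmall 𝒟 h𝒟⟩

/-- **Rung r1b, existential shape ⇒ the data settle.** Under
`SoloBlindTiedMinkowskiStabilityExists`, every datum of the Bieri–CK smallness class on `ℝ³`
satisfies `SoloBlindSettles`: a maximal vacuum Cauchy development exists, and every maximal vacuum
Cauchy development has complete `𝓘⁺` and a final state decomposition satisfying all clauses of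
`FinalStateConjecture` (the `N = 0` packaging theorem `SoloBlindTiedFlatChart.settles`, transported
to all maximal developments by MGHD uniqueness, `soloBlind_settles_iff_exists`).
Christodoulou–Klainerman 1993, Thm. 1.0.3. -/
theorem soloBlind_settles_of_tiedMinkowskiStabilityExists
    (h : SoloBlindTiedMinkowskiStabilityExists) :
    ∃ (s : ℕ), ∃ δ ∈ Set.Ioo (-3 / 2 : ℝ) (-1 / 2), ∃ ε > (0 : ℝ),
      ∀ (D : InitialDataSet 𝓘(ℝ, E3) Minkowski.slice) [D.metric.HasLeviCivita],
        D.IsVacuumConstraintSolution → D.IsMaximalData →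
        (∃ M : ℝ, trivialAFEnd.IsStronglyAsymptoticallyFlatCK D M) →
        InitialDataSet.dataWeightedSobolevEDist s δ D trivialData < ENNReal.ofReal ε →
        SoloBlindSettles Minkowski.slice D := by
  obtain ⟨s, δ, hδ, ε, hε, H⟩ := h
  refine ⟨s, δ, hδ, ε, hε, fun D _ hvac hmax hCK hsmall ↦ ?_⟩
  obtain ⟨𝒟, h𝒟, hI, ⟨c⟩⟩ := H D hvac hmax hCK hsmall
  exact soloBlind_settles_iff_exists.2 ⟨𝒟, h𝒟, hI, c.settles⟩

/-- **Rung r1b, universal shape ⇒ the data settle** (with MGHD existence,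
`choquetBruhat_geroch_exists_mghd_cauchy`, for the existence conjunct of `SoloBlindSettles`).
Christodoulou–Klainerman 1993, Thm. 1.0.3; Choquet-Bruhat–Geroch 1969, Thm. 3. -/
theorem soloBlind_settles_of_tiedMinkowskiStability (h : SoloBlindTiedMinkowskiStability)
    (hCBG : choquetBruhat_geroch_exists_mghd_cauchy) :
    ∃ (s : ℕ), ∃ δ ∈ Set.Ioo (-3 / 2 : ℝ) (-1 / 2), ∃ ε > (0 : ℝ),
      ∀ (D : InitialDataSet 𝓘(ℝ, E3) Minkowski.slice) [D.metric.HasLeviCivita],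
        D.IsVacuumConstraintSolution → D.IsMaximalData →
        (∃ M : ℝ, trivialAFEnd.IsStronglyAsymptoticallyFlatCK D M) →
        InitialDataSet.dataWeightedSobolevEDist s δ D trivialData < ENNReal.ofReal ε →
        SoloBlindSettles Minkowski.slice D :=
  soloBlind_settles_of_tiedMinkowskiStabilityExists
    (soloBlindTiedMinkowskiStabilityExists_of h hCBG)

/-- **The dispersive development directly**: under the universal shape, every maximal vacuum
Cauchy development of a datum of the class has complete `𝓘⁺` and a final state decomposition with
NO black hole (`N = 0`) of `O = J⁺(ι X)` satisfying all clauses of the statement — no transport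
needed. Christodoulou–Klainerman 1993, Thm. 1.0.3 ("the solution disperses"). -/
theorem soloBlind_disperses_of_tiedMinkowskiStability (h : SoloBlindTiedMinkowskiStability) :
    ∃ (s : ℕ), ∃ δ ∈ Set.Ioo (-3 / 2 : ℝ) (-1 / 2), ∃ ε > (0 : ℝ),
      ∀ (D : InitialDataSet 𝓘(ℝ, E3) Minkowski.slice) [D.metric.HasLeviCivita],
        D.IsVacuumConstraintSolution → D.IsMaximalData →
        (∃ M : ℝ, trivialAFEnd.IsStronglyAsymptoticallyFlatCK D M) →
        InitialDataSet.dataWeightedSobolevEDist s δ D trivialData < ENNReal.ofReal ε →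
        ∀ 𝒟 : VacuumCauchyDevelopment D, 𝒟.IsMaximal →
          HasCompleteNullInfinity 𝒟.toCauchyDevelopment ∧
            ∃ d : FinalStateDecomposition 𝒟.toSpacetime
                (soloBlindDataFuture 𝒟.toCauchyDevelopment) 2,
              d.N = 0 ∧ soloBlindDataFuture 𝒟.toCauchyDevelopment =
                  exteriorOf 𝒟.toCauchyDevelopment d.charted ∧
                RaysStayInClosure 𝒟.toCauchyDevelopment
                    (soloBlindDataFuture 𝒟.toCauchyDevelopment) ∧
                  HasExhaustiveCharts d ∧ IsFutureOriented d := by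
  obtain ⟨s, δ, hδ, ε, hε, H⟩ := h
  refine ⟨s, δ, hδ, ε, hε, fun D _ hvac hmax hCK hsmall 𝒟 h𝒟 ↦ ?_⟩
  obtain ⟨hI, ⟨c⟩⟩ := H D hvac hmax hCK hsmall 𝒟 h𝒟
  exact ⟨hI, c.decomposition, rfl, c.dataFuture_eq_exteriorOf,
    SoloBlindTiedFlatChart.raysStayInClosure _, c.hasExhaustiveCharts, c.isFutureOriented⟩

end Summit.FinalStateConjecture.FinalStateConjecture.Theorems

end
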